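import Summits.Ventures.WeilGRH.KeySectionClosure
import Summits.Ventures.WeilGRH.TwistedWindowClosure
import HarnessLib

/-!
# The section door for KEYS is two-way: test positivity ⟺ positivity on `K(t)` ⟺ all sections PSD

Cell `rh-explicit`, WEIL TRACK — GRH ARM (weil-grh-5; `GRH-LIT-AS-PRINTED.md` A42).  Sequel of
`KeySectionClosure.lean` (sections PSD ⇒ `WeilPositivityOnKey`) and the KEY analogue of weil-3's
`TwistedWindowClosure.lean` (the case of a character `χ`): for any key `(κ, L, v)` and any window `b > 0`,

* `keyMarkovForm_nonneg_of_test_nonneg_of_smoothInside` — if the key form is `≥ 0` on the test functions of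
  `[-b, b]`, it is `≥ 0` on every window function on `[-b, b]` that is smooth INSIDE the window (it may JUMP at
  `±b`: trigonometric sections, Yoshida's `K(b)`, the flat window) — smooth interior cut-offs `η_k·u ∈ C(b)`
  (`WeilFormatCWindowCutoff.lean`), uniform archimedean majorant `D_t(η_k u) ≤ K₁t ∧ 8bS₀²`, dominated convergence;
* `keyMarkovForm_nonneg_of_test_nonneg_of_mem_K`, `…_sum_smul_chi_nonneg_of_test_nonneg`;
* `test_nonneg_iff_forall_mem_K`, `test_nonneg_iff_forall_section_nonneg` — positivity on `C(b)`, on `K(b)` and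
  on all trigonometric sections are EQUIVALENT for every key (the format loses nothing);
* `weilPositivityOnKey_iff_forall_section_nonneg` (`κ ≤ 1`, `N' ≥ 1`, window `t_{N'} = log(N'+1)/2`) and the
  soundness of NEGATIVE section certificates AT THE SAME WINDOW: `not_weilPositivityOnKey_of_section_neg` (one
  coefficient vector with a negative section value refutes the key rung — e.g. the exactness claims «q₀ − 1 fails»
  of weil-grh-2's pseudo-key floor ladder become typable refutations).

Everything is proved; no definitions, no named facts, RH/GRH-free.
[cite: Yoshida1992, §0 p. 282 («we can extend ( , ) to K(a)») and §3 p. 289; Weil1952FormulesExplicites,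
(11) pp. 261–262]
-/

set_option autoImplicit false

noncomputable section

open Complex Filter Set MeasureTheory
open scoped Real Topology ComplexConjugate ContDiff ArithmeticFunction.vonMangoldt

namespace Summit.Ventures.WeilGRH

open Literature.NumberTheory.LFunctions
open Literature.NumberTheory.LFunctions.Yoshida1992 (modes chi chiCore contDiff_chiCore)
open Summit.RiemannHypothesis.RiemannHypothesis.Theorems.WeilFormatC

variable {b : ℝ} {φ : ℝ → ℂ} {u : ℕ → ℝ → ℂ} {S₀ : ℝ}

/-- **The key form converges along an a.e.-convergent bounded window family with an archimedean majorant**: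
`keyMarkovForm κ L v c (u_N) → keyMarkovForm κ L v c φ` (any key, any window parameter `c`). [folklore] -/
theorem tendsto_keyMarkovForm_of_ae_tendsto_of_le (hum : ∀ N, Measurable (u N))
    (huz : ∀ N x, x ∉ Icc (-b) b → u N x = 0) (hub : ∀ N x, ‖u N x‖ ≤ S₀)
    (hpt : ∀ᵐ x : ℝ, Tendsto (fun N ↦ u N x) atTop (𝓝 (φ x))) {m : ℝ → ℝ}
    (hm : IntegrableOn (fun t ↦ weilArchDensity t * m t) (Ioi 0))
    (hdom : ∀ N t, 0 < t → weilIncrement (u N) t ≤ m t) (κ : ℕ) (L : ℝ) (v : ℕ → ℂ) (c : ℝ) :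
    Tendsto (fun N ↦ keyMarkovForm κ L v c (u N)) atTop (𝓝 (keyMarkovForm κ L v c φ)) := by
  have hinc : ∀ t, Tendsto (fun N ↦ weilIncrement (u N) t) atTop (𝓝 (weilIncrement φ t)) :=
    tendsto_weilIncrement_of_ae_tendsto hum huz hub hpt
  have htw : ∀ (w₀ : ℂ) (t : ℝ),
      Tendsto (fun N ↦ weilTwistIncrement w₀ (u N) t) atTop (𝓝 (weilTwistIncrement w₀ φ t)) :=
    tendsto_weilTwistIncrement_of_ae_tendsto hum huz hub hpt
  have harch := tendsto_archIntegralPar_of_le hum hm hdom (fun t _ ↦ hinc t) κ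
  have hprime : Tendsto (fun N ↦ ∑ n ∈ weilPrimeIndex c, (Λ n : ℝ) / Real.sqrt n *
      weilTwistIncrement (conj (v n)) (u N) (Real.log n)) atTop
      (𝓝 (∑ n ∈ weilPrimeIndex c, (Λ n : ℝ) / Real.sqrt n * weilTwistIncrement (conj (v n)) φ (Real.log n))) :=
    tendsto_finsetSum _ fun n _ ↦ (htw _ _).const_mul _
  have hnorm := tendsto_integral_norm_sq_of_ae_tendsto hum huz hub hpt
  unfold keyMarkovForm keyDirichletEnergy
  exact (hprime.add harch).sub (hnorm.const_mul _)

/-- **Test positivity forces the key form to be non-negative on every smooth-inside window function.**  `b > 0`;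
the key form of `(κ, L, v)` at window `b` is `≥ 0` on the test functions of `[-b, b]`; `w` is a window function on
`[-b, b]` agreeing on the closed window with a smooth `f` (so `w` may jump at `±b`).  Then
`0 ≤ keyMarkovForm κ L v b w`.  (weil-3's `twistedWindowForm_nonneg_of_weilPositivityOnChar`, verbatim for keys.)
[cite: Yoshida1992, §0 p. 282] -/
theorem keyMarkovForm_nonneg_of_test_nonneg_of_smoothInside (hb : 0 < b) {κ : ℕ} {L : ℝ} {v : ℕ → ℂ}
    (hW : ∀ g : ℝ → ℂ, IsWeilTest g → tsupport g ⊆ Icc (-b) b → 0 ≤ keyMarkovForm κ L v b g)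
    {w f : ℝ → ℂ} (hw : IsWindowFunction b w) (hf : ContDiff ℝ ∞ f) (hwf : ∀ x ∈ Icc (-b) b, w x = f x) :
    0 ≤ keyMarkovForm κ L v b w := by
  obtain ⟨hwm, hwz, ⟨S₀, hS₀⟩, ⟨S₁', hS₁'⟩⟩ := hw
  set S₁ := max S₁' 0 with hS₁def
  have hS₁0 : 0 ≤ S₁ := le_max_right _ _
  have hS₁ : ∀ x y, x ∈ Icc (-b) b → y ∈ Icc (-b) b → ‖w y - w x‖ ≤ S₁ * |y - x| := fun x y hx hy ↦
    (hS₁' x y hx hy).trans (mul_le_mul_of_nonneg_right (le_max_left _ _) (abs_nonneg _))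
  have hS₀0 : 0 ≤ S₀ := (norm_nonneg _).trans (hS₀ 0)
  obtain ⟨C, hC0, hC⟩ := exists_lipschitz_smoothTransition
  -- transition widths `ε_k = b/(2(k+2)) → 0`, `2ε_k ≤ b`
  set ε : ℕ → ℝ := fun k ↦ b / ((k : ℝ) + 2) / 2 with hεdef
  have hε : ∀ k, 0 < ε k := fun k ↦ by positivity
  have h2ε : ∀ k, 2 * ε k ≤ b := fun k ↦ by
    have : b / ((k : ℝ) + 2) ≤ b := div_le_self hb.le (by linarith [(Nat.cast_nonneg k : (0 : ℝ) ≤ k)])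
    show 2 * (b / ((k : ℝ) + 2) / 2) ≤ b
    linarith
  have hεto : Tendsto ε atTop (𝓝 0) := by
    have h1 : Tendsto (fun k : ℕ ↦ b / ((k : ℝ) + 2)) atTop (𝓝 0) :=
      tendsto_const_nhds.div_atTop (tendsto_atTop_add_const_right _ _ tendsto_natCast_atTop_atTop)
    simpa [hεdef] using h1.div_const 2
  choose η hηs hη01 hη1 hη0 hηL using fun k ↦ exists_smooth_plateau (a := b) (hε k) hC
  have hηm : ∀ k, Measurable (η k) := fun k ↦ (hηs k).continuous.measurable
  -- the approximants `g_k = η_k · f = η_k · w ∈ C(b)`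
  set g : ℕ → ℝ → ℂ := fun k x ↦ (η k x : ℂ) * f x with hgdef
  have hgw : ∀ k x, g k x = (η k x : ℂ) * w x := by
    intro k x
    by_cases hx : x ∈ Icc (-b) b
    · simp only [hgdef, hwf x hx]
    · have hxb : b - ε k ≤ |x| := by
        have : b < |x| := lt_abs_of_not_mem_Icc_window hx
        linarith [hε k]
      simp only [hgdef, hη0 k x hxb, Complex.ofReal_zero, zero_mul]
  have hgw' : ∀ k, g k = fun x ↦ (η k x : ℂ) * w x := fun k ↦ funext (hgw k)
  have hgz : ∀ k x, x ∉ Icc (-b) b → g k x = 0 := fun k x hx ↦ by rw [hgw, hwz x hx, mul_zero]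
  have hgb : ∀ k x, ‖g k x‖ ≤ S₀ := fun k x ↦ by
    rw [hgw, norm_mul, Complex.norm_real, Real.norm_eq_abs, abs_of_nonneg (hη01 k x).1]
    calc η k x * ‖w x‖ ≤ 1 * S₀ := by
          gcongr
          · exact (hη01 k x).2
          · exact hS₀ x
      _ = S₀ := one_mul _
  have hofR : ContDiff ℝ ∞ (fun x : ℝ ↦ (x : ℂ)) := Complex.ofRealCLM.contDiff
  have hgsmooth : ∀ k, ContDiff ℝ ∞ (g k) := fun k ↦ (hofR.comp (hηs k)).mul hf
  have hgm : ∀ k, Measurable (g k) := fun k ↦ (hgsmooth k).continuous.measurable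
  have hgsupp : ∀ k, tsupport (g k) ⊆ Icc (-b) b := fun k ↦
    closure_minimal (fun x hx ↦ by_contra fun h ↦ hx (hgz k x h)) isClosed_Icc
  have hgtest : ∀ k, IsWeilTest (g k) := fun k ↦
    ⟨hgsmooth k, HasCompactSupport.intro isCompact_Icc (hgz k)⟩
  have hpos : ∀ k, 0 ≤ keyMarkovForm κ L v b (g k) := fun k ↦ hW (g k) (hgtest k) (hgsupp k)
  -- almost-everywhere convergence `g_k → w` (everywhere off `{b, −b}`)
  have hpt : ∀ᵐ x : ℝ, Tendsto (fun k ↦ g k x) atTop (𝓝 (w x)) := by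
    have hnull : ∀ᵐ x : ℝ, x ∈ ({b, -b} : Set ℝ)ᶜ :=
      compl_mem_ae_iff.2 ((Set.toFinite _).measure_zero _)
    refine hnull.mono fun x hx ↦ ?_
    simp only [mem_compl_iff, mem_insert_iff, mem_singleton_iff, not_or] at hx
    rcases lt_or_ge b |x| with hxb | hxb
    · have hx' : x ∉ Icc (-b) b := fun h ↦ by
        have := abs_le.2 ⟨h.1, h.2⟩; linarith
      rw [hwz x hx']
      exact tendsto_const_nhds.congr' (Eventually.of_forall fun k ↦ (hgz k x hx').symm)
    · have hlt : |x| < b := lt_of_le_of_ne hxb fun h ↦ by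
        rcases (abs_eq hb.le).1 h with h' | h'
        · exact hx.1 h'
        · exact hx.2 h'
      have hr : (0 : ℝ) < (b - |x|) / 2 := by linarith
      have hev : ∀ᶠ k in atTop, w x = g k x := by
        filter_upwards [hεto.eventually (gt_mem_nhds hr)] with k hk
        rw [hgw, hη1 k x (by linarith), Complex.ofReal_one, one_mul]
      exact tendsto_const_nhds.congr' hev
  -- the archimedean majorant, uniform in `k`
  set Λ' : ℝ := b * S₁ + 2 * C * S₀ with hΛ'
  set K₁ : ℝ := 4 * b * S₁ ^ 2 + 4 * S₀ ^ 2 + 8 * (2 * Λ' ^ 2 + 10 * S₀ ^ 2) with hK₁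
  set K₂ : ℝ := 8 * b * S₀ ^ 2 with hK₂
  set cst : ℝ := max (K₁ / 2) (K₂ / (8 * b)) with hcst
  have hdom : ∀ k t, 0 < t → weilIncrement (g k) t ≤ cst * (if t ≤ 1 then 2 * t else 8 * b) := by
    intro k t ht
    by_cases ht1 : t ≤ 1
    · rw [if_pos ht1]
      have hmain := weilIncrement_cutoff_le hb (hε k) (h2ε k) hwm hwz hS₀ hS₁ hS₁0 hC0 (hηm k) (hη01 k)
        (hη1 k) (hηL k) ht
      rw [← hgw' k] at hmain
      have ht2 : t ^ 2 ≤ t := by nlinarith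
      have h3 : 4 * b * S₁ ^ 2 * t ^ 2 ≤ 4 * b * S₁ ^ 2 * t := mul_le_mul_of_nonneg_left ht2 (by positivity)
      calc weilIncrement (g k) t ≤ K₁ * t := by
            rw [hK₁, hΛ']; linarith [hmain, h3]
        _ = K₁ / 2 * (2 * t) := by ring
        _ ≤ cst * (2 * t) := by gcongr; exact le_max_left _ _
    · rw [if_neg ht1]
      calc weilIncrement (g k) t ≤ 8 * b * S₀ ^ 2 :=
            weilIncrement_le_window_const hb.le (hgm k) (hgz k) (hgb k) t
        _ = K₂ / (8 * b) * (8 * b) := by rw [hK₂]; field_simp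
        _ ≤ cst * (8 * b) := by gcongr; exact le_max_right _ _
  have hM : IntegrableOn (fun t ↦ weilArchDensity t * (cst * (if t ≤ 1 then 2 * t else 8 * b))) (Ioi 0) := by
    have h0 := integrableOn_archBound hb.le (1 : ℝ) (0 : ℝ)
    have h1 : IntegrableOn (fun t : ℝ ↦ weilArchDensity t * (if t ≤ 1 then 2 * t else 8 * b)) (Ioi 0) :=
      h0.congr_fun (fun t _ ↦ by norm_num) measurableSet_Ioi
    exact IntegrableOn.congr_fun (h1.const_mul cst) (fun t _ ↦ by ring) measurableSet_Ioi
  exact ge_of_tendsto' (tendsto_keyMarkovForm_of_ae_tendsto_of_le hgm hgz hgb hpt hM hdom κ L v b) hpos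

/-- **Every trigonometric section has a non-negative key form under test positivity** (`b > 0`; any finite
set of modes). [cite: Yoshida1992, §3 p. 289] -/
theorem keyMarkovForm_sum_smul_chi_nonneg_of_test_nonneg (hb : 0 < b) {κ : ℕ} {L : ℝ} {v : ℕ → ℂ}
    (hW : ∀ g : ℝ → ℂ, IsWeilTest g → tsupport g ⊆ Icc (-b) b → 0 ≤ keyMarkovForm κ L v b g)
    (s : Finset ℤ) (c : ℤ → ℂ) :
    0 ≤ keyMarkovForm κ L v b (∑ n ∈ s, c n • chi b n) := by
  refine keyMarkovForm_nonneg_of_test_nonneg_of_smoothInside hb hW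
    (f := fun x ↦ ∑ n ∈ s, c n • chiCore b n x)
    (IsWindowFunction.sum s c fun n _ ↦ isWindowFunction_chi hb n)
    (ContDiff.sum fun n _ ↦ (contDiff_chiCore b n).const_smul (c n)) fun x hx ↦ ?_
  simp only [Finset.sum_apply, Pi.smul_apply, chi, indicator_of_mem hx]

/-- **Test positivity ⟹ positivity of the key form on all of Yoshida's `K(b)`** (`b > 0`). [cite: Yoshida1992, §0 p. 282] -/
theorem keyMarkovForm_nonneg_of_test_nonneg_of_mem_K (hb : 0 < b) {κ : ℕ} {L : ℝ} {v : ℕ → ℂ}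
    (hW : ∀ g : ℝ → ℂ, IsWeilTest g → tsupport g ⊆ Icc (-b) b → 0 ≤ keyMarkovForm κ L v b g)
    (hφ : φ ∈ Yoshida1992.K b) :
    0 ≤ keyMarkovForm κ L v b φ := by
  have hwin := isWindowFunction_of_mem_K hφ
  obtain ⟨f, hf, -, hφf, -⟩ := hφ
  exact keyMarkovForm_nonneg_of_test_nonneg_of_smoothInside hb hW hwin hf
    fun x hx ↦ hφf x (abs_le.2 ⟨hx.1, hx.2⟩)

/-- **`C(b)` versus `K(b)`**: for every key and every `b > 0`, the key form is `≥ 0` on the test functions of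
`[-b, b]` iff it is `≥ 0` on all of Yoshida's `K(b)`. [cite: Yoshida1992, §0 p. 282] -/
theorem test_nonneg_iff_forall_mem_K (hb : 0 < b) (κ : ℕ) (L : ℝ) (v : ℕ → ℂ) :
    (∀ g : ℝ → ℂ, IsWeilTest g → tsupport g ⊆ Icc (-b) b → 0 ≤ keyMarkovForm κ L v b g) ↔
      ∀ φ ∈ Yoshida1992.K b, 0 ≤ keyMarkovForm κ L v b φ :=
  ⟨fun hW _ hφ ↦ keyMarkovForm_nonneg_of_test_nonneg_of_mem_K hb hW hφ,
    fun h g hg hsupp ↦ h g (Yoshida1992.C_le_K hb ⟨hg, hsupp⟩)⟩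

/-- **THE KEY FORMAT IS COMPLETE**: for every key `(κ, L, v)` and `b > 0`, the key form is `≥ 0` on the test
functions of `[-b, b]` iff it is `≥ 0` on EVERY trigonometric section `Σ_{|n|≤N} c_n χ_n` — positivity holds iff
all truncations of the section Gram form are positive semidefinite. [cite: Yoshida1992, §0 p. 282 and §3 p. 289] -/
theorem test_nonneg_iff_forall_section_nonneg (hb : 0 < b) (κ : ℕ) (L : ℝ) (v : ℕ → ℂ) :
    (∀ g : ℝ → ℂ, IsWeilTest g → tsupport g ⊆ Icc (-b) b → 0 ≤ keyMarkovForm κ L v b g) ↔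
      ∀ (N : ℕ) (c : ℤ → ℂ), 0 ≤ keyMarkovForm κ L v b (∑ n ∈ modes N, c n • chi b n) :=
  ⟨fun hW N c ↦ keyMarkovForm_sum_smul_chi_nonneg_of_test_nonneg hb hW (modes N) c,
    fun h _ hg hsupp ↦ keyMarkovForm_nonneg_of_forall_section_nonneg hb h (Yoshida1992.C_le_K hb ⟨hg, hsupp⟩)⟩

/-- **`WeilPositivityOnKey` ⟺ all sections PSD** (`κ ≤ 1`, `N' ≥ 1`, window `t = log(N'+1)/2`): the key rung
holds iff the key form is `≥ 0` on every trigonometric section of `K(t)`. [cite: Yoshida1992, §0 p. 282] -/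
theorem weilPositivityOnKey_iff_forall_section_nonneg {κ : ℕ} (hκ : κ ≤ 1) (L : ℝ) (v : ℕ → ℂ) {N' : ℕ}
    (hN' : 1 ≤ N') :
    WeilPositivityOnKey κ L v N' ↔ ∀ (N : ℕ) (c : ℤ → ℂ),
      0 ≤ keyMarkovForm κ L v (Real.log ((N' : ℝ) + 1) / 2)
        (∑ n ∈ modes N, c n • chi (Real.log ((N' : ℝ) + 1) / 2) n) := by
  have ht0 : 0 < Real.log ((N' : ℝ) + 1) / 2 := by
    have h1 : (1 : ℝ) < (N' : ℝ) + 1 := by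
      have : (1 : ℝ) ≤ (N' : ℝ) := by exact_mod_cast hN'
      linarith
    exact div_pos (Real.log_pos h1) two_pos
  rw [weilPositivityOnKey_iff_keyMarkovForm_nonneg hκ L v N']
  exact test_nonneg_iff_forall_section_nonneg ht0 κ L v

/-- **`WeilPositivityOnKey` ⟹ every section of `K(t)` is PSD** (the necessity half, any finite set of modes).
[cite: Yoshida1992, §0 p. 282] -/
theorem keyMarkovForm_sum_smul_chi_nonneg_of_weilPositivityOnKey {κ : ℕ} (hκ : κ ≤ 1) {L : ℝ} {v : ℕ → ℂ}
    {N' : ℕ} (hN' : 1 ≤ N') (hW : WeilPositivityOnKey κ L v N') (s : Finset ℤ) (c : ℤ → ℂ) :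
    0 ≤ keyMarkovForm κ L v (Real.log ((N' : ℝ) + 1) / 2)
      (∑ n ∈ s, c n • chi (Real.log ((N' : ℝ) + 1) / 2) n) := by
  have ht0 : 0 < Real.log ((N' : ℝ) + 1) / 2 := by
    have h1 : (1 : ℝ) < (N' : ℝ) + 1 := by
      have : (1 : ℝ) ≤ (N' : ℝ) := by exact_mod_cast hN'
      linarith
    exact div_pos (Real.log_pos h1) two_pos
  rw [weilPositivityOnKey_iff_keyMarkovForm_nonneg hκ L v N'] at hW
  exact keyMarkovForm_sum_smul_chi_nonneg_of_test_nonneg ht0 hW s c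

/-- **Soundness of NEGATIVE section certificates at the SAME window**: one coefficient vector on finitely many
modes whose section has a negative key form refutes `WeilPositivityOnKey κ L v N'` (`κ ≤ 1`, `N' ≥ 1`; e.g. the
exactness half «conductor `q₀ − 1` fails» of a pseudo-key floor). [folklore] -/
theorem not_weilPositivityOnKey_of_section_neg {κ : ℕ} (hκ : κ ≤ 1) {L : ℝ} {v : ℕ → ℂ} {N' : ℕ}
    (hN' : 1 ≤ N') {s : Finset ℤ} {c : ℤ → ℂ}
    (h : keyMarkovForm κ L v (Real.log ((N' : ℝ) + 1) / 2)
      (∑ n ∈ s, c n • chi (Real.log ((N' : ℝ) + 1) / 2) n) < 0) :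
    ¬ WeilPositivityOnKey κ L v N' :=
  fun hW ↦ not_lt.2 (keyMarkovForm_sum_smul_chi_nonneg_of_weilPositivityOnKey hκ hN' hW s c) h

/-- Section-Gram form of the refutation: a negative value of `Re Σ_mΣ_n c_m conj(c_n) G_v(m,n)`
(`G_v(m,n) = keyWindowSesq κ L v t (χ_m, χ_n)`) refutes the key rung. [cite: Yoshida1992, §5 (5.13)–(5.16)] -/
theorem not_weilPositivityOnKey_of_sectionGram_neg {κ : ℕ} (hκ : κ ≤ 1) {L : ℝ} {v : ℕ → ℂ} {N' : ℕ}
    (hN' : 1 ≤ N') {s : Finset ℤ} {c : ℤ → ℂ}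
    (h : (∑ m ∈ s, ∑ n ∈ s, c m * conj (c n) *
      keyWindowSesq κ L v (Real.log ((N' : ℝ) + 1) / 2)
        (chi (Real.log ((N' : ℝ) + 1) / 2) m) (chi (Real.log ((N' : ℝ) + 1) / 2) n)).re < 0) :
    ¬ WeilPositivityOnKey κ L v N' := by
  have ht0 : 0 < Real.log ((N' : ℝ) + 1) / 2 := by
    have h1 : (1 : ℝ) < (N' : ℝ) + 1 := by
      have : (1 : ℝ) ≤ (N' : ℝ) := by exact_mod_cast hN'
      linarith
    exact div_pos (Real.log_pos h1) two_pos
  refine not_weilPositivityOnKey_of_section_neg hκ hN' (s := s) (c := c) ?_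
  rw [keyMarkovForm_sum_smul_chi ht0 s c κ L v]
  exact h

end Summit.Ventures.WeilGRH

end
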